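import Summits.BirchSwinnertonDyer.BirchSwinnertonDyer.Theorems.AdditiveKolyvaginRoadAdditiveKolyvaginKernel
import Summits.BirchSwinnertonDyer.BirchSwinnertonDyer.Theorems.AdditiveKolyvaginRoadBottomRankOneAdditiveClassOfPoint
import Summits.BirchSwinnertonDyer.Rank1Residual.X11b.BDPRouteRigidity
import Summits.BirchSwinnertonDyer.Rank1Residual.X11b.BDPRouteOnTreeStepL
import Summits.BirchSwinnertonDyer.Rank1Residual.X11b.KolyvaginBottomPoint
import Summits.BirchSwinnertonDyer.Rank1Residual.X11b.Three.StepLAtThree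
import Literature.NumberTheory.EllipticCurves.BSDSelmerCMPConverseRankOneProofs
import Literature.NumberTheory.EllipticCurves.BSDSelmerSkinnerProofs
import Literature.NumberTheory.EllipticCurves.HeegnerPointsRationalityProofs
import Literature.NumberTheory.EllipticCurves.HeegnerPointsClassesProofs
import HarnessLib

/-!
# Route `AdditiveKolyvaginRoad`, crux `BottomRankOneAdditive` (item stmt-BirchSwinnertonDyer-21397):
# the crux is TIGHT — `BSD_p(E)` in rank one and `BSD_p(E^{(d_K)})` in rank zero FORCE the bottom Heegner
# point `y_K` to be `p`-indivisible at every ♯ frame with `#Sel_p(E/K) = p`; hence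
# `BottomRankOneAdditive ⟸ PublishedInputs ∧ RankZeroAdditive ∧ (the kernel's conclusion)`
# (cell `pub/bsd-wall`, lead prover `bsd-wall-akr-p3` g0; `--supports stmt-BirchSwinnertonDyer-21397`, helper)

THEOREMS ONLY (no definition, no named fact, no `sorry`); nothing about Kolyvagin's conjecture and nothing about
`BSD(E,p)` is asserted — every `p`-part of BSD and every published input below is a HYPOTHESIS. BSD is not proved by
any of this.

THE POINT (the additive twin, at the BOTTOM, of imc-p1's `ErratumRoadFiveKolyvaginFramesTight` §2 on class X11b).
The route's kernel `AdditiveKolyvaginKernel` (p561799) reads the crux chain FORWARD: published inputs → Manin-good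
frames → `KolyvaginPrimitiveAdditive` (⟸ KS′ ∧ BOT′ by item 21266) → `RankZeroAdditive` → `BSDp W p` on every ♯
additive rank-one row. This file reads the BOTTOM backwards, in the point currency of the lead's skeleton v2
(`Cruxes/BottomRankOneAdditive/Lines/birth.lean`, stubs `stub_heegnerPointIndivisible{Abelian,Supercuspidal}Type`:
♯ frame ∧ `#Sel_p(E/K) = p` ⇒ `∀ d, ¬ Koly.PDiv d p 1`):

* §1 `heegnerPoint_not_pDiv_of_bsdp_of_bsdp_twist` — at ONE ♯ frame `(W, p ≥ 5, K, Dt, β, ι)` (additive `p`,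
  `ρ̄_{E,p}` onto, `p ∤ ∏ c_ℓ`, `r_an = 1`, `K` imaginary quadratic with `d_K` odd, Heegner hypothesis,
  `L(E^{(d_K)},1) ≠ 0`, `4N ∣ β² − d_K`, `p ∤ c(Dt)`) with `#Sel_p(E/K) = p`: `BSDp W p` and `BSDp Wd p` for a minimal
  model `Wd` of the twist `E^{(d_K)}`, granted Gross–Zagier, Kolyvagin, GZK and modularity (named facts, binders), give
  `P(1) = y_K ∉ p·E(K[1])` for EVERY conductor-`1` datum. Route: W. Zhang 2014 Remark 5 ∕ Thm. 10.2 read backwards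
  at the bottom — `BSDp W p` ⇒ the lower half `ord_p #Ш(E)_an ≤ ord_p #Ш(E)` (`Typed.missingPPartAt_of_bsdp`);
  `BSDp Wd p` in rank `0` ⇒ the rank-zero print shape (`pPart_of_bsdp`, `pPartRankZero_of_pPart`); the Gross–Zagier
  bookkeeping over `K` (`X11b.indexLowerBoundAt_of_missingLowerBoundAt`, multr1-p2, with the Tamagawa transport
  `X2.padicValNat_tamagawaProduct_twist_of_heegner_of_odd` and `ord_p u(Cd) = 0`
  `X11b.padicValRat_u_eq_zero_of_twist_minimal_of_splitsIn`) ⇒ STEP L `2·ord_p [E(K):ℤ y_K] ≤ ord_p #Ш(E/K) +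
  2·ord_p ∏ c_ℓ`; `#Sel_p(E/K) = p` with `rank E(K) = 1` (Kolyvagin) and `E(K)[p] = 0` (`ρ̄` irreducible) ⇒
  `Ш(E/K)[p^∞] = 0` (`primaryComponent_sha_eq_bot_of_card_selmerGroup_eq`); so `ord_p [E(K):ℤ y_K] = 0`, i.e.
  `y_K ∉ p·E(K)` (`Koly.padicValNat_index_zmultiples_eq_of_divisibility`), i.e. `P(1) ∉ p·E(K[1])`
  (`Koly.pDiv_one_iff_exists_zsmul_eq`, Shimura reciprocity at conductor `1` PROVED).
* §2 `exists_kolyvaginClass_one_ne_zero_of_bsdp_of_bsdp_twist` — the same in the crux's currency: some conductor-`1`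
  datum has `c(1) ≠ 0` (glue `stub_kolyvaginClassOneOfNotPDiv`, landed in `…BottomRankOneAdditiveClassOfPoint`).
* §3 `bottomRankOneAdditive_of_rankZeroAdditive_of_sharpRankOne` — CLASS LEVEL, against the route's decls:
  `PublishedInputsAdditiveKoly → RankZeroAdditive → (∀ ♯ additive rank-one row, BSDp W p) → BottomRankOneAdditive`.
  The third antecedent is VERBATIM the conclusion of `AdditiveKolyvaginKernel`; so, modulo the published inputs and
  the rank-zero residual (both antecedents of the kernel too), the crux `BottomRankOneAdditive` carries NO SURPLUS
  over what the kernel proves from it: a disproof of BOT′ on a ♯ frame would be a disproof of `BSD_p` at a ♯ additive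
  rank-one row or at a non-CM additive rank-zero row.

References (locators only): [cite: WZhang2014, Remark 5 and Thm. 10.2] [cite: GrossZagier1986, V.§2 (2.2)]
[cite: JetchevSkinnerWan2017, §7.4.1 (eq:gz), (eq:tamK)] [cite: McCallumLMS1991, §5 Lemma 5.1]
[cite: GrossLMS1991, §2 (2.2)–(2.3), §4 (P_1 = y_K)] [cite: Darmon2004, Thm. 3.6–3.7] [cite: BurungaleTian2019, Cor. 1.4 (proof)].
-/

-- single-conjunct summit: `Summit.BirchSwinnertonDyer.BirchSwinnertonDyer.…` repeats the name by design
set_option linter.dupNamespace false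

set_option autoImplicit false

noncomputable section

open scoped Classical

namespace Summit.BirchSwinnertonDyer.BirchSwinnertonDyer.Theorems.AdditiveKoly

open WeierstrassCurve NumberField Field
  Literature.NumberTheory.EllipticCurves Literature.NumberTheory.EllipticCurves.ModularForms
  Literature.NumberTheory.EllipticCurves.Rank1Residual
  Summit.BirchSwinnertonDyer.Rank1Residual Summit.BirchSwinnertonDyer.Rank1Residual.X11b
  Summit.BirchSwinnertonDyer.Rank1Residual.X11b.Three
  Summit.BirchSwinnertonDyer.BirchSwinnertonDyer.Theses.AdditiveKolyvaginRoad

/-! ## §1 One ♯ frame: `BSD_p(E) ∧ BSD_p(E^{(d_K)})` force `y_K ∉ p·E(K[1])` -/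

section Frame

variable (W : WeierstrassCurve ℚ) [W.IsElliptic] [W.IsGloballyMinimal] [NeZero (W.conductorNorm ℤ)]
  (p : ℕ) [hp : Fact p.Prime] (K : Type) [Field K] [NumberField K]
  (Dt : ModularParametrizationData W (W.conductorNorm ℤ)) (β : ℤ) (ι : K →+* ℂ)

/-- **TIGHTNESS OF THE BOTTOM CRUX AT ONE ♯ FRAME (point currency).** Data: `W/ℚ` globally minimal elliptic, `p ≥ 5`
additive with `ρ̄_{E,p}` onto and `p ∤ ∏ c_ℓ(E)`, `ord_{s=1} L(E,s) = 1`; `K` imaginary quadratic with `d_K` odd, the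
Heegner hypothesis for `N_E` and `L(E^{(d_K)},1) ≠ 0`; a frame `(Dt, β, ι)` with `4N_E ∣ β² − d_K` and `p ∤ c(Dt)`; and
`#Sel_p(E/K) = p`. PUBLISHED inputs as binders: Gross–Zagier `hGZ`, Kolyvagin `hKo`, GZK `hGZK`, modularity `hmod`.
HYPOTHESES: `BSDp W p`, and `BSDp Wd p` for every globally minimal model `Wd = Cd • E^{(d_K)}` of the twist.
CONCLUSION: for EVERY conductor-`1` Kolyvagin–Heegner datum `d` on the frame, `P(1) ∉ p·E(K[1])`
(`¬ Koly.PDiv d p 1`) — the conclusion of the open stubs of skeleton v2. Proof: lower half of `BSD(E,p)` + rank-zero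
print shape of the twist + Gross–Zagier bookkeeping over `K` ⇒ STEP L at `y_K`; `#Sel_p = p`, rank one, no
`p`-torsion ⇒ `Ш(E/K)[p^∞] = 0`; hence `ord_p [E(K):ℤ y_K] = 0`; descend/ascend between `E(K)` and `E(K[1])` by
McCallum's Lemma 5.1 with Gross's Lemma 4.3. CONDITIONAL on every binder; nothing is booked.
[cite: WZhang2014, Remark 5 and Thm. 10.2] [cite: JetchevSkinnerWan2017, §7.4.1] [cite: McCallumLMS1991, §5 Lemma 5.1]
[cite: BurungaleTian2019, Cor. 1.4 (proof: #Sel = p^rank · #E[p] · #Ш[p])] -/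
theorem heegnerPoint_not_pDiv_of_bsdp_of_bsdp_twist
    -- published inputs (named facts of the tree)
    (hGZ : gross_zagier (W.conductorNorm ℤ) W K) (hKo : kolyvagin (W.conductorNorm ℤ) W K)
    (hGZK : rank_eq_analyticRank_of_analyticRank_le_one) (hmod : hasEntireLFunction_rat)
    -- the frame (the binders of the open stubs that are used)
    (hp5 : 5 ≤ p) (hadd : Addv W p) (hs : W.HasSurjectiveModNGaloisRep p)
    (htam : ¬ p ∣ W.tamagawaProduct) (hr : W.analyticRank = 1)
    (hK : IsImaginaryQuadratic K) (hodd : Odd (NumberField.discr K))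
    (hH : SatisfiesHeegnerHypothesis (W.conductorNorm ℤ) K)
    (hL : (W.quadraticTwist (NumberField.discr K : ℚ)).entireLFunction 1 ≠ 0)
    (hβ : (4 * (W.conductorNorm ℤ : ℤ)) ∣ β ^ 2 - NumberField.discr K) (hc : ¬ (p : ℤ) ∣ Dt.c)
    (hSel : Nat.card (WeierstrassCurve.selmerGroup (W.baseChange K) (p : ℤ)) = p)
    -- the two `p`-parts of BSD: for `E` (analytic rank 1) and for the twist `E^{(d_K)}` (analytic rank 0)
    (hbsd : BSDp W p)
    (hbsdTw : ∀ (Wd : WeierstrassCurve ℚ) [Wd.IsElliptic] [Wd.IsGloballyMinimal] (Cd : VariableChange ℚ),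
      Cd • W.quadraticTwist (NumberField.discr K : ℚ) = Wd → BSDp Wd p) :
    ∀ d : KolyvaginHeegnerData Dt β ι 1, ¬ Koly.PDiv d p 1 := by
  intro d
  have hpP : p.Prime := hp.out
  have hp2 : p ≠ 2 := by omega
  have hirr : W.HasIrreducibleModPGaloisRep p :=
    hasIrreducibleModPGaloisRep_of_hasSurjectiveModNGaloisRep W p hs
  -- `p ∣ N` (additive) splits in `K`: `p ∤ d_K`, `p ∤ #𝓞_K^×`
  have hpN : p ∣ W.conductorNorm ℤ :=
    (W.dvd_conductorNorm_iff_not_hasGoodReductionAtPrime p).mpr hadd.1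
  have hpd : ¬ (p : ℤ) ∣ NumberField.discr K :=
    Literature.SatisfiesHeegnerHypothesis.not_dvd_discr hK.1 hH hpP hpN
  obtain ⟨-, hμ⟩ := not_dvd_discr_and_not_dvd_torsionOrder_of_heegner hK hH hp2 hpN
  -- an oriented Heegner datum `H` with `H.β = β` and THE Heegner point `P = y_K ∈ E(K)` (Darmon 3.6, proved)
  have hDneg : NumberField.discr K < 0 := hK.discr_neg
  obtain ⟨H, hHβ⟩ := exists_heegnerDatum (W.conductorNorm ℤ) hDneg hβ
  obtain ⟨P, hP⟩ := heegnerPointComplex_mem_range_map_holds (W.conductorNorm ℤ) W K hK hH Dt H ι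
  -- a globally minimal model `Wd` of the twist `E^{(d_K)}`: analytic rank 0, `BSDp Wd p`, print shape
  have hD0 : (NumberField.discr K : ℚ) ≠ 0 := by exact_mod_cast NumberField.discr_ne_zero K
  haveI hEt : (W.quadraticTwist (NumberField.discr K : ℚ)).IsElliptic := W.isElliptic_quadraticTwist hD0
  obtain ⟨Cd, hCd⟩ := hasGlobalMinimalModel_rat_holds (W.quadraticTwist (NumberField.discr K : ℚ))
  haveI := hCd
  set Wd : WeierstrassCurve ℚ := Cd • W.quadraticTwist (NumberField.discr K : ℚ) with hWd_def
  have hWd : Cd • W.quadraticTwist (NumberField.discr K : ℚ) = Wd := rfl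
  have hLt' : (W.quadraticTwist (NumberField.discr K : ℚ)).entireLFunction = Wd.entireLFunction := by
    rw [← hWd, entireLFunction_smul]
  have hLd1 : Wd.entireLFunction 1 ≠ 0 := by rw [← hLt']; exact hL
  have hrd : Wd.analyticRank = 0 := (Wd.analyticRank_eq_zero_iff_holds (hmod Wd)).2 hLd1
  have hBSDd : BSDp Wd p := hbsdTw Wd Cd hWd
  obtain ⟨qd, hqd, hvqd⟩ :
      PPartRankZero Wd p := pPartRankZero_of_pPart hGZK Wd p hrd (pPart_of_bsdp hmod hGZK Wd p (by omega) hBSDd)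
  have htamEq : padicValNat p Wd.tamagawaProduct = padicValNat p W.tamagawaProduct :=
    X2.padicValNat_tamagawaProduct_twist_of_heegner_of_odd W p hp2 K hK hodd hpd hH Cd hWd
  have hu : padicValRat p (Cd.u : ℚ) = 0 :=
    X11b.padicValRat_u_eq_zero_of_twist_minimal_of_splitsIn W p K hK.1 (hH p hpP hpN) Cd hWd
  -- the lower half of `BSD(E,p)` from `BSDp W p`
  haveI : Finite W.sha := (hGZK W (le_of_eq hr)).2
  have hlow : Typed.MissingLowerBoundAt W p :=
    (Typed.lower_and_upper_of_missingPPartAt W p (Typed.missingPPartAt_of_bsdp W p hbsd)).1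
  -- STEP L at `P`: `2·ord_p [E(K):ℤP] ≤ ord_p #Ш(E/K) + 2·ord_p ∏ c_ℓ(E)`
  have hStepL : IndexLowerBoundAt W p K P :=
    indexLowerBoundAt_of_missingLowerBoundAt W p (W.conductorNorm ℤ) K Dt H ι P hGZ hKo hGZK hmod hK hH hP
      hp2 hc hμ hr hL Wd Cd hWd hu htamEq ⟨qd, hqd, hvqd.le⟩ hlow
  -- arithmetic of `E(K)`: `y_K` non-torsion (Gross–Zagier), rank one and `Ш(E/K)` finite (Kolyvagin), `E(K)[p] = 0`
  have hPinf : ¬ IsOfFinAddOrder P :=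
    not_isOfFinAddOrder_of_heegner_of_analyticRank_eq_one W (W.conductorNorm ℤ) K Dt H ι P hGZ hmod hr hK hH hL hP
  obtain ⟨hrank, hSha⟩ := hKo hK hH ⟨Dt, H, ι, hP⟩ hPinf
  haveI : Finite (W.baseChange K).sha := hSha
  have hbot := torsionBy_eq_bot_of_isImaginaryQuadratic_of_hasIrreducibleModPGaloisRep W K hK hpP hirr
  have hiv : ∀ x : (W.baseChange K).toAffine.Point, p • x = 0 → x = 0 := fun x hx ↦ by
    have hmem : x ∈ AddSubgroup.torsionBy (W.baseChange K).toAffine.Point ((p : ℕ) : ℤ) := by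
      rw [mem_torsionBy_iff, natCast_zsmul]
      exact hx
    rw [hbot] at hmem
    exact hmem
  -- `#Sel_p(E/K) = p`, rank one, `E(K)[p] = 0` ⟹ `Ш(E/K)[p^∞] = 0`
  have ht : Nat.card (AddSubgroup.torsionBy (W.baseChange K).toAffine.Point (p : ℤ)) = 1 := by
    rw [hbot]; exact AddSubgroup.card_bot
  have hShabot : AddCommGroup.primaryComponent (W.baseChange K).sha p = ⊥ :=
    primaryComponent_sha_eq_bot_of_card_selmerGroup_eq (W.baseChange K) p hSel hrank ht
  have hsha0 : padicValNat p (W.baseChange K).shaOrder = 0 := by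
    rw [Koly.padicValNat_shaOrder_eq (W.baseChange K) p, hShabot, AddSubgroup.card_bot, padicValNat_one_right]
  have htam0 : padicValNat p W.tamagawaProduct = 0 := padicValNat.eq_zero_of_not_dvd htam
  -- `p^{M₀} ∥ P` in `E(K)` and `ord_p [E(K):ℤP] = M₀`
  haveI : Module.Finite ℤ (W.baseChange K).toAffine.Point := (W.baseChange K).module_finite_point_holds
  obtain ⟨M₀, x₀, hx₀, hmax⟩ := exists_pow_smul_eq_and_forall_ne hPinf (p := p) hpP.two_le
  have hdiv : ∃ Q : (W.baseChange K).toAffine.Point, ((p ^ M₀ : ℕ) : ℤ) • Q = P :=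
    ⟨x₀, by rw [natCast_zsmul]; exact hx₀⟩
  have hndiv : ¬ ∃ Q : (W.baseChange K).toAffine.Point, ((p ^ (M₀ + 1) : ℕ) : ℤ) • Q = P := by
    rintro ⟨Q, hQ⟩
    exact hmax Q (by rw [← natCast_zsmul]; exact hQ)
  haveI : Finite (AddCommGroup.torsion (W.baseChange K).toAffine.Point) :=
    WeierstrassCurve.finite_torsion_point (W := W.baseChange K)
  obtain ⟨cc, Q, hcQ, hcker⟩ := RankOne.exists_coord_of_mordellWeilRank_eq_one (W.baseChange K) hrank
  have hidx : padicValNat p (AddSubgroup.zmultiples P).index = M₀ :=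
    Koly.padicValNat_index_zmultiples_eq_of_divisibility cc Q hcQ hcker hiv P hdiv hndiv
  -- STEP L now reads `2·M₀ ≤ 0`
  have hM0 : M₀ = 0 := by
    unfold IndexLowerBoundAt at hStepL
    rw [hidx, hsha0, htam0] at hStepL
    omega
  -- `P = y_K` maps to `P(1)` (Shimura reciprocity at conductor 1, proved); transfer to `E(K[1])`
  obtain ⟨P₀, -, hP₀⟩ := heegnerSystem_exists_isHeegnerPoint_map_eq_derivedPoint_one
    (heegnerPointOfConductor_one_galoisConj_holds (W.conductorNorm ℤ) W K) hK hH d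
  have hPP : P₀ = P := KolyvaginBottom.eq_of_map_eq_heegnerPointComplex
    (heegnerPointOfConductor_one_galoisConj_holds (W.conductorNorm ℤ) W K) hK hH d hHβ hP hP₀
  rw [hPP] at hP₀
  rw [pDiv_one_iff_exists_zsmul_eq_of_surj W p K Dt β ι hp2 hs hK d P hP₀ 1]
  rintro ⟨Qx, hQx⟩
  subst hM0
  have h1 := hmax Qx
  rw [zero_add] at h1
  rw [natCast_zsmul] at hQx
  exact h1 hQx

/-! ## §2 The same in the crux's currency -/

/-- **TIGHTNESS OF THE BOTTOM CRUX AT ONE ♯ FRAME (class currency)**: under the data and binders of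
`heegnerPoint_not_pDiv_of_bsdp_of_bsdp_twist` (in particular `d_K < −4` is NOT needed there but IS needed here, for
the `Γ_K`-invariance of `[P(1)]` via the glue), `BSDp W p` and `BSDp` of the twist give a conductor-`1` datum with
`c(1) = d.kolyvaginClass _ 1 ≠ 0` — the conclusion of `Theses.AdditiveKolyvaginRoad.BottomRankOneAdditive` at this
frame (glue `stub_kolyvaginClassOneOfNotPDiv`). CONDITIONAL on every binder; nothing is booked.
[cite: WZhang2014, Remark 5 and Thm. 10.2] [cite: McCallumLMS1991, Cor. 4.5 and Lemma 5.1] -/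
theorem exists_kolyvaginClass_one_ne_zero_of_bsdp_of_bsdp_twist
    (hGZ : gross_zagier (W.conductorNorm ℤ) W K) (hKo : kolyvagin (W.conductorNorm ℤ) W K)
    (hGZK : rank_eq_analyticRank_of_analyticRank_le_one) (hmod : hasEntireLFunction_rat)
    (hp5 : 5 ≤ p) (hadd : Addv W p) (hs : W.HasSurjectiveModNGaloisRep p)
    (htam : ¬ p ∣ W.tamagawaProduct) (hr : W.analyticRank = 1)
    (hK : IsImaginaryQuadratic K) (hodd : Odd (NumberField.discr K)) (hlt : NumberField.discr K < -4)
    (hH : SatisfiesHeegnerHypothesis (W.conductorNorm ℤ) K)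
    (hL : (W.quadraticTwist (NumberField.discr K : ℚ)).entireLFunction 1 ≠ 0)
    (hβ : (4 * (W.conductorNorm ℤ : ℤ)) ∣ β ^ 2 - NumberField.discr K) (hc : ¬ (p : ℤ) ∣ Dt.c)
    (hSel : Nat.card (WeierstrassCurve.selmerGroup (W.baseChange K) (p : ℤ)) = p)
    (hbsd : BSDp W p)
    (hbsdTw : ∀ (Wd : WeierstrassCurve ℚ) [Wd.IsElliptic] [Wd.IsGloballyMinimal] (Cd : VariableChange ℚ),
      Cd • W.quadraticTwist (NumberField.discr K : ℚ) = Wd → BSDp Wd p) :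
    ∃ d : KolyvaginHeegnerData Dt β ι 1, d.kolyvaginClass hp.out 1 ≠ 0 :=
  stub_kolyvaginClassOneOfNotPDiv W p K Dt β ι hp5 hs hK hlt hH hβ
    (heegnerPoint_not_pDiv_of_bsdp_of_bsdp_twist W p K Dt β ι hGZ hKo hGZK hmod hp5 hadd hs htam hr hK hodd hH
      hL hβ hc hSel hbsd hbsdTw)

end Frame

/-! ## §3 Class level, against the route's decls -/

/-- **`BottomRankOneAdditive ⟸ PublishedInputsAdditiveKoly ∧ RankZeroAdditive ∧ (the kernel's conclusion)`.**
Granted the route's published-inputs conjunction (only Gross–Zagier, Kolyvagin, GZK and modularity are used) and its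
rank-zero residual `RankZeroAdditive` (`BSD_p` for every non-CM additive rank-zero row at `p ≥ 5` — it feeds the
twist `E^{(d_K)}`, which is non-CM, additive at `p` and of analytic rank `0` by the kernel's
`AdditiveKolyvaginKernel.twist_nonCM_addv_rankZero`; non-CM of `E` from a multiplicative prime ♠(2)), the statement
«`BSDp W p` at every ♯ additive rank-one row» — VERBATIM the conclusion of the route's kernel
`Theses.AdditiveKolyvaginRoad.AdditiveKolyvaginKernel` — implies the crux `BottomRankOneAdditive` (§2 frame by frame).
So, modulo antecedents the kernel also carries, the bottom crux has NO surplus over what the kernel proves from the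
crux chain. CONDITIONAL on every antecedent; nothing is booked. [cite: WZhang2014, Remark 5 and Thm. 10.2]
[cite: GrossZagier1986, V.§2 (2.2)] [cite: McCallumLMS1991, §5 Lemma 5.1, §4 Cor. 4.5] -/
theorem bottomRankOneAdditive_of_rankZeroAdditive_of_sharpRankOne
    (hPub : PublishedInputsAdditiveKoly) (h₀ : RankZeroAdditive)
    (hsharp : ∀ (W : WeierstrassCurve ℚ) [W.IsElliptic] [W.IsGloballyMinimal] (p : ℕ) [Fact p.Prime],
      ¬ W.HasCM → 5 ≤ p → Addv W p → W.analyticRank = 1 → W.HasSurjectiveModNGaloisRep p →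
      (∀ (ℓ : ℕ) [Fact ℓ.Prime], W.HasMultiplicativeReductionAtPrime ℓ →
        ¬ p ∣ padicValInt ℓ W.minimalDiscriminantInt) →
      (∃ (ℓ₁ ℓ₂ : ℕ) (_ : Fact ℓ₁.Prime) (_ : Fact ℓ₂.Prime), ℓ₁ ≠ ℓ₂ ∧
        W.HasMultiplicativeReductionAtPrime ℓ₁ ∧ W.HasMultiplicativeReductionAtPrime ℓ₂) →
      ¬ p ∣ W.tamagawaProduct → BSDp W p) :
    BottomRankOneAdditive := by
  intro W _ _ _ p _ K _ _ Dt β ι hp5 hadd hs hsp htwo htam hr hK hodd hlt hH hL hβ hc hSel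
  obtain ⟨hGZ, hKo, -, hGZK, hmod, -, -, -, -, -⟩ := hPub
  -- non-CM from a multiplicative prime
  obtain ⟨ℓ₁, ℓ₂, hℓ₁, hℓ₂, hne, hm₁, hm₂⟩ := htwo
  have hCM : ¬ W.HasCM := not_hasCM_of_hasMultiplicativeReductionAtPrime' W hm₁
  -- `BSDp W p` at this ♯ row, and `BSDp` of every minimal twist model from the rank-zero residual
  have hbsd : BSDp W p := hsharp W p hCM hp5 hadd hr hs hsp ⟨ℓ₁, ℓ₂, hℓ₁, hℓ₂, hne, hm₁, hm₂⟩ htam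
  have hbsdTw : ∀ (Wd : WeierstrassCurve ℚ) [Wd.IsElliptic] [Wd.IsGloballyMinimal] (Cd : VariableChange ℚ),
      Cd • W.quadraticTwist (NumberField.discr K : ℚ) = Wd → BSDp Wd p := by
    intro Wd _ _ Cd hWd
    obtain ⟨hCMd, haddd, hrd⟩ :=
      AdditiveKolyvaginKernel.twist_nonCM_addv_rankZero hmod W p hCM hadd K hK hH hL Wd Cd hWd
    exact h₀ Wd p hCMd hp5 haddd hrd
  exact exists_kolyvaginClass_one_ne_zero_of_bsdp_of_bsdp_twist W p K Dt β ι (hGZ _ W K) (hKo _ W K) hGZK hmod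
    hp5 hadd hs htam hr hK hodd hlt hH hL hβ hc hSel hbsd hbsdTw

end Summit.BirchSwinnertonDyer.BirchSwinnertonDyer.Theorems.AdditiveKoly

end
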